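import Summits.Ventures.PercRepro.ThetaOmegaGraph

/-!
# The graph form of (Ω) holds for three members

`three_le_omegaCountG`: a family of exactly three subsets of `U`, with any SYMMETRIC graph of
independence number ≤ 2 on its six slots, has at least three meets over the edges of the graph —
the `|F| = 3` case of Conjecture (Ω_Γ) for every ground set. If the count were at most two, every
first-slot meet and every difference over an edge would be one set `d` and every co-join over an
edge one set `c` (`ThreeData`); the triples `{x, y, z'}` and `{x, y', z'}` then force, when
`d ≠ ∅`, a common meet and a common join of the three members (two of them coincide by
distributivity, `ThreeData.false_of_ne_empty`), and when `d = ∅`, an inclusion pattern that again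
identifies two members (`ThreeData.false_of_empty`). Corollaries: the relation form for every
symmetric relation with the triple condition (`card_le_omegaCountR_of_card_eq_three`) and, for the
pentagon, **(PENT) for three members** (`card_le_omegaCountR_pent_of_card_eq_three`: the `|F| = 3`
cells of row C-050, for every ground set). Dossier: Addendum 84 (mine-1, gen 45).
-/

namespace PercRepro.MSTight

open Finset

variable {α : Type*} [DecidableEq α] {L : Type*}

section ThreeMembers

variable {Γ : Slot α → Slot α → Prop} {U : Finset α} {s t u : Finset α}

/-- A set contained in `y` and equal to a difference `x \ y` is empty. -/
theorem eq_empty_of_subset_of_sdiff_eq {d x y : Finset α} (hd : d ⊆ y) (h : x \ y = d) :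
    d = ∅ := by
  subst h
  ext a
  simp only [Finset.notMem_empty, iff_false]
  intro ha
  exact (mem_sdiff.1 ha).2 (hd ha)

/-- A subset of `y` meeting `y` in the empty set is empty. -/
theorem eq_empty_of_subset_of_inf_eq {x y : Finset α} (h : x ⊆ y) (h0 : x ⊓ y = ∅) : x = ∅ := by
  rw [inf_eq_left.2 h] at h0
  exact h0

/-- A subset of `x` meeting `x` in the empty set is empty. -/
theorem eq_empty_of_subset_of_inf_eq' {x y : Finset α} (h : y ⊆ x) (h0 : x ⊓ y = ∅) : y = ∅ := by
  rw [inf_eq_right.2 h] at h0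
  exact h0

/-- Two relative co-joins of subsets of `U` agree iff the joins agree. -/
theorem sup_eq_sup_of_cojoin_eq {a b c d : Finset α} (ha : a ⊆ U) (hb : b ⊆ U) (hc : c ⊆ U)
    (hd : d ⊆ U) (h : U \ (a ⊔ b) = U \ (c ⊔ d)) : a ⊔ b = c ⊔ d := by
  have h1 : a ⊔ b ⊆ U := sup_le ha hb
  have h2 : c ⊔ d ⊆ U := sup_le hc hd
  rw [← Finset.sdiff_sdiff_eq_self h1, h, Finset.sdiff_sdiff_eq_self h2]

/-- The data of a three-member instance `s, t, u ∈ F` whose graph count is at most two: all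
first-slot meets and differences over edges equal `d`, all co-joins over edges equal `c`, and the
triple conditions in their two mixed shapes (the graph symmetric). -/
structure ThreeData (Γ : Slot α → Slot α → Prop) (U : Finset α) (F : Finset (Finset α))
    (s t u : Finset α) (d c : Finset α) : Prop where
  hS : s ∈ F
  hT : t ∈ F
  hU : u ∈ F
  hsU : s ⊆ U
  htU : t ⊆ U
  huU : u ⊆ U
  hst : s ≠ t
  hsu : s ≠ u
  htu : t ≠ u
  meet : ∀ x y, x ∈ F → y ∈ F → x ≠ y → Γ (topSlot x) (topSlot y) → x ⊓ y = d
  diff : ∀ x y, x ∈ F → y ∈ F → Γ (topSlot x) (botSlot y) → x \ y = d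
  cojoin : ∀ x y, x ∈ F → y ∈ F → x ≠ y → Γ (botSlot x) (botSlot y) → U \ (x ⊔ y) = c
  ttb : ∀ x y z, x ∈ F → y ∈ F → z ∈ F → x ≠ y →
    Γ (topSlot x) (topSlot y) ∨ Γ (topSlot x) (botSlot z) ∨ Γ (topSlot y) (botSlot z)
  tbb : ∀ x y z, x ∈ F → y ∈ F → z ∈ F → y ≠ z →
    Γ (topSlot x) (botSlot y) ∨ Γ (topSlot x) (botSlot z) ∨ Γ (botSlot y) (botSlot z)

namespace ThreeData

variable {F : Finset (Finset α)} {d c : Finset α}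

/-- The roles of `s` and `t` may be swapped. -/
theorem swap (D : ThreeData Γ U F s t u d c) : ThreeData Γ U F t s u d c :=
  ⟨D.hT, D.hS, D.hU, D.htU, D.hsU, D.huU, D.hst.symm, D.htu, D.hsu, D.meet, D.diff, D.cojoin,
    D.ttb, D.tbb⟩

/-- The roles may be rotated: `(s, t, u) ↦ (u, s, t)`. -/
theorem rotate (D : ThreeData Γ U F s t u d c) : ThreeData Γ U F u s t d c :=
  ⟨D.hU, D.hS, D.hT, D.huU, D.hsU, D.htU, D.hsu.symm, D.htu.symm, D.hst, D.meet, D.diff, D.cojoin,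
    D.ttb, D.tbb⟩

/-- **Case `d ≠ ∅` with the first-slot edge `st`**: the three members have a common meet and a
common join, so two of them coincide. -/
theorem false_of_ne_empty (D : ThreeData Γ U F s t u d c) (hd : d ≠ ∅)
    (hst : Γ (topSlot s) (topSlot t)) : False := by
  have hS := D.hS; have hT := D.hT; have hU := D.hU
  have hstd : s ⊓ t = d := D.meet s t hS hT D.hst hst
  have hd_s : d ⊆ s := by rw [← hstd]; exact inter_subset_left
  have hd_t : d ⊆ t := by rw [← hstd]; exact inter_subset_right
  -- `s ⊓ u = d`
  have hsud : s ⊓ u = d := by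
    rcases D.ttb s u t hS hU hT D.hsu with h | h | h
    · exact D.meet s u hS hU D.hsu h
    · exact absurd (eq_empty_of_subset_of_sdiff_eq hd_t (D.diff s t hS hT h)) hd
    · exact absurd (eq_empty_of_subset_of_sdiff_eq hd_t (D.diff u t hU hT h)) hd
  have hd_u : d ⊆ u := by rw [← hsud]; exact inter_subset_right
  -- `t ⊓ u = d`
  have htud : t ⊓ u = d := by
    rcases D.ttb t u s hT hU hS D.htu with h | h | h
    · exact D.meet t u hT hU D.htu h
    · exact absurd (eq_empty_of_subset_of_sdiff_eq hd_s (D.diff t s hT hS h)) hd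
    · exact absurd (eq_empty_of_subset_of_sdiff_eq hd_s (D.diff u s hU hS h)) hd
  -- the three co-joins
  have htuc : U \ (t ⊔ u) = c := by
    rcases D.tbb s t u hS hT hU D.htu with h | h | h
    · exact absurd (eq_empty_of_subset_of_sdiff_eq hd_t (D.diff s t hS hT h)) hd
    · exact absurd (eq_empty_of_subset_of_sdiff_eq hd_u (D.diff s u hS hU h)) hd
    · exact D.cojoin t u hT hU D.htu h
  have hsuc : U \ (s ⊔ u) = c := by
    rcases D.tbb t s u hT hS hU D.hsu with h | h | h
    · exact absurd (eq_empty_of_subset_of_sdiff_eq hd_s (D.diff t s hT hS h)) hd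
    · exact absurd (eq_empty_of_subset_of_sdiff_eq hd_u (D.diff t u hT hU h)) hd
    · exact D.cojoin s u hS hU D.hsu h
  have hjoin : s ⊔ t = s ⊔ u := by
    rcases D.tbb u s t hU hS hT D.hst with h | h | h
    · exact absurd (eq_empty_of_subset_of_sdiff_eq hd_s (D.diff u s hU hS h)) hd
    · exact absurd (eq_empty_of_subset_of_sdiff_eq hd_t (D.diff u t hU hT h)) hd
    · have hstc : U \ (s ⊔ t) = c := D.cojoin s t hS hT D.hst h
      exact sup_eq_sup_of_cojoin_eq D.hsU D.htU D.hsU D.huU (hstc.trans hsuc.symm)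
  have hmeet : t ⊓ s = u ⊓ s := by rw [inf_comm, hstd, inf_comm, hsud]
  have hjoin' : t ⊔ s = u ⊔ s := by rw [sup_comm, hjoin, sup_comm]
  exact D.htu (eq_of_inf_eq_sup_eq hmeet hjoin')

/-- **Case `d = ∅` with `s = ∅`**: the other two members coincide. -/
theorem false_of_empty_s (D : ThreeData Γ U F s t u ∅ c) (hs : s = ∅) : False := by
  have hS := D.hS; have hT := D.hT; have hU := D.hU
  have ht0 : t ≠ ∅ := fun h => D.hst (hs.trans h.symm)
  have hu0 : u ≠ ∅ := fun h => D.hsu (hs.trans h.symm)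
  have hnot : ∀ x, x ∈ F → x ≠ ∅ → ¬ Γ (topSlot x) (botSlot s) := by
    intro x hx hx0 h
    have := D.diff x s hx hS h
    rw [hs, sdiff_empty] at this
    exact hx0 this
  have htu : t ⊓ u = ∅ := by
    rcases D.ttb t u s hT hU hS D.htu with h | h | h
    · exact D.meet t u hT hU D.htu h
    · exact absurd h (hnot t hT ht0)
    · exact absurd h (hnot u hU hu0)
  have hsu : U \ (s ⊔ u) = c := by
    rcases D.tbb t s u hT hS hU D.hsu with h | h | h
    · exact absurd h (hnot t hT ht0)
    · have := sdiff_eq_empty_iff_subset.1 (D.diff t u hT hU h)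
      exact (ht0 (eq_empty_of_subset_of_inf_eq this htu)).elim
    · exact D.cojoin s u hS hU D.hsu h
  have hst : U \ (s ⊔ t) = c := by
    rcases D.tbb u s t hU hS hT D.hst with h | h | h
    · exact absurd h (hnot u hU hu0)
    · have := sdiff_eq_empty_iff_subset.1 (D.diff u t hU hT h)
      exact (hu0 (eq_empty_of_subset_of_inf_eq' this htu)).elim
    · exact D.cojoin s t hS hT D.hst h
  have := sup_eq_sup_of_cojoin_eq D.hsU D.huU D.hsU D.htU (hsu.trans hst.symm)
  rw [hs] at this
  simp only [sup_eq_union, empty_union] at this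
  exact D.htu this.symm

/-- **Case `d = ∅`, no member empty, `u ⊆ s`**: then `t ⊆ s`, against `s ⊓ t = ∅`. -/
theorem false_of_subset (D : ThreeData Γ U F s t u ∅ c) (hs0 : s ≠ ∅) (ht0 : t ≠ ∅)
    (hst0 : s ⊓ t = ∅) (hus : u ⊆ s) : False := by
  have hS := D.hS; have hT := D.hT; have hU := D.hU
  have htuc : U \ (t ⊔ u) = c := by
    rcases D.tbb s t u hS hT hU D.htu with h | h | h
    · have := sdiff_eq_empty_iff_subset.1 (D.diff s t hS hT h)
      exact (hs0 (eq_empty_of_subset_of_inf_eq this hst0)).elim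
    · have := sdiff_eq_empty_iff_subset.1 (D.diff s u hS hU h)
      exact (D.hsu (subset_antisymm this hus)).elim
    · exact D.cojoin t u hT hU D.htu h
  have hsuc : U \ (s ⊔ u) = c := by
    rcases D.tbb t s u hT hS hU D.hsu with h | h | h
    · have := sdiff_eq_empty_iff_subset.1 (D.diff t s hT hS h)
      exact (ht0 (eq_empty_of_subset_of_inf_eq' this hst0)).elim
    · have := sdiff_eq_empty_iff_subset.1 (D.diff t u hT hU h)
      exact (ht0 (eq_empty_of_subset_of_inf_eq' (this.trans hus) hst0)).elim
    · exact D.cojoin s u hS hU D.hsu h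
  have hj := sup_eq_sup_of_cojoin_eq D.htU D.huU D.hsU D.huU (htuc.trans hsuc.symm)
  rw [sup_eq_left.2 hus] at hj
  have hts : t ⊆ s := by rw [← hj]; exact subset_union_left
  exact ht0 (eq_empty_of_subset_of_inf_eq' hts hst0)

/-- **Case `d = ∅` with the first-slot edge `st`.** -/
theorem false_of_empty (D : ThreeData Γ U F s t u ∅ c) (hst : Γ (topSlot s) (topSlot t)) :
    False := by
  have hS := D.hS; have hT := D.hT; have hU := D.hU
  have hst0 : s ⊓ t = ∅ := D.meet s t hS hT D.hst hst
  by_cases hs0 : s = ∅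
  · exact D.false_of_empty_s hs0
  by_cases ht0 : t = ∅
  · exact D.swap.false_of_empty_s ht0
  by_cases hu0 : u = ∅
  · exact D.rotate.false_of_empty_s hu0
  by_cases hus : u ⊆ s
  · exact D.false_of_subset hs0 ht0 hst0 hus
  by_cases hut : u ⊆ t
  · exact D.swap.false_of_subset ht0 hs0 (by rw [inf_comm]; exact hst0) hut
  -- `u ⊄ s`, `u ⊄ t`
  have hstc : U \ (s ⊔ t) = c := by
    rcases D.tbb u s t hU hS hT D.hst with h | h | h
    · exact absurd (sdiff_eq_empty_iff_subset.1 (D.diff u s hU hS h)) hus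
    · exact absurd (sdiff_eq_empty_iff_subset.1 (D.diff u t hU hT h)) hut
    · exact D.cojoin s t hS hT D.hst h
  have hsu0 : s ⊓ u = ∅ := by
    rcases D.ttb s u t hS hU hT D.hsu with h | h | h
    · exact D.meet s u hS hU D.hsu h
    · have := sdiff_eq_empty_iff_subset.1 (D.diff s t hS hT h)
      exact (hs0 (eq_empty_of_subset_of_inf_eq this hst0)).elim
    · exact absurd (sdiff_eq_empty_iff_subset.1 (D.diff u t hU hT h)) hut
  have htu0 : t ⊓ u = ∅ := by
    rcases D.ttb t u s hT hU hS D.htu with h | h | h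
    · exact D.meet t u hT hU D.htu h
    · have := sdiff_eq_empty_iff_subset.1 (D.diff t s hT hS h)
      exact (ht0 (eq_empty_of_subset_of_inf_eq' this hst0)).elim
    · exact absurd (sdiff_eq_empty_iff_subset.1 (D.diff u s hU hS h)) hus
  have htuc : U \ (t ⊔ u) = c := by
    rcases D.tbb s t u hS hT hU D.htu with h | h | h
    · have := sdiff_eq_empty_iff_subset.1 (D.diff s t hS hT h)
      exact (hs0 (eq_empty_of_subset_of_inf_eq this hst0)).elim
    · have := sdiff_eq_empty_iff_subset.1 (D.diff s u hS hU h)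
      exact (hs0 (eq_empty_of_subset_of_inf_eq this hsu0)).elim
    · exact D.cojoin t u hT hU D.htu h
  have hj := sup_eq_sup_of_cojoin_eq D.htU D.huU D.hsU D.htU (htuc.trans hstc.symm)
  -- `u ⊆ s ⊔ t` while `u` is disjoint from both: `u = ∅`
  have hu_sub : u ⊆ s ⊔ t := by rw [← hj]; exact subset_union_right
  apply hu0
  ext a
  simp only [Finset.notMem_empty, iff_false]
  intro ha
  rcases mem_union.1 (hu_sub ha) with h | h
  · exact Finset.notMem_empty a (hsu0 ▸ mem_inter.2 ⟨h, ha⟩)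
  · exact Finset.notMem_empty a (htu0 ▸ mem_inter.2 ⟨h, ha⟩)

/-- A three-member instance with all counted sets collapsed is impossible. -/
theorem false_of_data (D : ThreeData Γ U F s t u d c) (hst : Γ (topSlot s) (topSlot t)) : False := by
  by_cases hd : d = ∅
  · subst hd; exact D.false_of_empty hst
  · exact D.false_of_ne_empty hd hst

end ThreeData

section Main

variable {Γ : Slot α → Slot α → Prop} [DecidableRel Γ] {U : Finset α} {F : Finset (Finset α)}

omit [DecidableEq α] [DecidableRel Γ] in
/-- Folding the two orientations of each pair of a symmetric graph. -/
theorem fold_three (hsym : ∀ u v, Γ u v → Γ v u) {a b c : Slot α}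
    (h : Γ a b ∨ Γ b a ∨ Γ a c ∨ Γ c a ∨ Γ b c ∨ Γ c b) : Γ a b ∨ Γ a c ∨ Γ b c := by
  rcases h with h | h | h | h | h | h
  · exact Or.inl h
  · exact Or.inl (hsym _ _ h)
  · exact Or.inr (Or.inl h)
  · exact Or.inr (Or.inl (hsym _ _ h))
  · exact Or.inr (Or.inr h)
  · exact Or.inr (Or.inr (hsym _ _ h))

/-- **The graph form holds for three members**: a family of exactly three subsets of `U`, with any
symmetric graph of independence number ≤ 2 on its six slots, has at least three meets over the
edges of the graph. -/
theorem three_le_omegaCountG (hsym : ∀ u v, Γ u v → Γ v u) (hF : ∀ x ∈ F, x ⊆ U)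
    (h3 : F.card = 3) (hT : SlotTripleRel Γ F) : 3 ≤ omegaCountG Γ U F := by
  obtain ⟨s, t, u, hst, hsu, htu, rfl⟩ := card_eq_three.1 h3
  have hS : s ∈ ({s, t, u} : Finset (Finset α)) := mem_insert_self _ _
  have hTm : t ∈ ({s, t, u} : Finset (Finset α)) := mem_insert_of_mem (mem_insert_self _ _)
  have hU : u ∈ ({s, t, u} : Finset (Finset α)) :=
    mem_insert_of_mem (mem_insert_of_mem (mem_singleton_self _))
  -- the two families
  set A := omegaAR Γ ({s, t, u} : Finset (Finset α)) topSlot botSlot with hA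
  set C := omegaCR Γ U ({s, t, u} : Finset (Finset α)) botSlot with hC
  have hcount : omegaCountG Γ U ({s, t, u} : Finset (Finset α)) = A.card + C.card := rfl
  -- the triple conditions in the three shapes
  have ttt : Γ (topSlot s) (topSlot t) ∨ Γ (topSlot s) (topSlot u) ∨ Γ (topSlot t) (topSlot u) :=
    fold_three hsym (hT (topSlot s) (topSlot t) (topSlot u) hS hTm hU
      (fun h => hst (topSlot_injective h)) (fun h => hsu (topSlot_injective h))
      (fun h => htu (topSlot_injective h)))
  have bbb : Γ (botSlot s) (botSlot t) ∨ Γ (botSlot s) (botSlot u) ∨ Γ (botSlot t) (botSlot u) :=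
    fold_three hsym (hT (botSlot s) (botSlot t) (botSlot u) hS hTm hU
      (fun h => hst (botSlot_injective h)) (fun h => hsu (botSlot_injective h))
      (fun h => htu (botSlot_injective h)))
  have ttb : ∀ x y z, x ∈ ({s, t, u} : Finset (Finset α)) → y ∈ ({s, t, u} : Finset (Finset α)) →
      z ∈ ({s, t, u} : Finset (Finset α)) → x ≠ y →
      Γ (topSlot x) (topSlot y) ∨ Γ (topSlot x) (botSlot z) ∨ Γ (topSlot y) (botSlot z) := by
    intro x y z hx hy hz hxy
    exact fold_three hsym (hT (topSlot x) (topSlot y) (botSlot z) hx hy hz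
      (fun h => hxy (topSlot_injective h)) (topSlot_ne_botSlot x z) (topSlot_ne_botSlot y z))
  have tbb : ∀ x y z, x ∈ ({s, t, u} : Finset (Finset α)) → y ∈ ({s, t, u} : Finset (Finset α)) →
      z ∈ ({s, t, u} : Finset (Finset α)) → y ≠ z →
      Γ (topSlot x) (botSlot y) ∨ Γ (topSlot x) (botSlot z) ∨ Γ (botSlot y) (botSlot z) := by
    intro x y z hx hy hz hyz
    exact fold_three hsym (hT (topSlot x) (botSlot y) (botSlot z) hx hy hz (topSlot_ne_botSlot x y)
      (topSlot_ne_botSlot x z) (fun h => hyz (botSlot_injective h)))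
  -- membership of the counted sets
  have meet_mem : ∀ x y, x ∈ ({s, t, u} : Finset (Finset α)) → y ∈ ({s, t, u} : Finset (Finset α)) →
      x ≠ y → Γ (topSlot x) (topSlot y) → x ⊓ y ∈ A :=
    fun x y hx hy hxy h => mem_omegaAR.2 (Or.inl ⟨x, hx, y, hy, hxy, h, rfl⟩)
  have diff_mem : ∀ x y, x ∈ ({s, t, u} : Finset (Finset α)) → y ∈ ({s, t, u} : Finset (Finset α)) →
      Γ (topSlot x) (botSlot y) → x \ y ∈ A :=
    fun x y hx hy h => mem_omegaAR.2 (Or.inr ⟨x, hx, y, hy, h, rfl⟩)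
  have cojoin_mem : ∀ x y, x ∈ ({s, t, u} : Finset (Finset α)) →
      y ∈ ({s, t, u} : Finset (Finset α)) → x ≠ y → Γ (botSlot x) (botSlot y) → U \ (x ⊔ y) ∈ C :=
    fun x y hx hy hxy h => mem_omegaCR.2 ⟨x, hx, y, hy, hxy, h, rfl⟩
  -- both families are nonempty
  have hA1 : 1 ≤ A.card := by
    apply card_pos.2
    rcases ttt with h | h | h
    · exact ⟨_, meet_mem s t hS hTm hst h⟩
    · exact ⟨_, meet_mem s u hS hU hsu h⟩
    · exact ⟨_, meet_mem t u hTm hU htu h⟩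
  have hC1 : 1 ≤ C.card := by
    apply card_pos.2
    rcases bbb with h | h | h
    · exact ⟨_, cojoin_mem s t hS hTm hst h⟩
    · exact ⟨_, cojoin_mem s u hS hU hsu h⟩
    · exact ⟨_, cojoin_mem t u hTm hU htu h⟩
  by_contra hlt
  rw [hcount] at hlt
  have hA' : A.card = 1 := by omega
  have hC' : C.card = 1 := by omega
  obtain ⟨d, hd⟩ := card_eq_one.1 hA'
  obtain ⟨c, hc⟩ := card_eq_one.1 hC'
  have D : ThreeData Γ U {s, t, u} s t u d c :=
    { hS := hS
      hT := hTm
      hU := hU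
      hsU := hF s hS
      htU := hF t hTm
      huU := hF u hU
      hst := hst
      hsu := hsu
      htu := htu
      meet := fun x y hx hy hxy h => by
        have := meet_mem x y hx hy hxy h
        rw [hd, mem_singleton] at this
        exact this
      diff := fun x y hx hy h => by
        have := diff_mem x y hx hy h
        rw [hd, mem_singleton] at this
        exact this
      cojoin := fun x y hx hy hxy h => by
        have := cojoin_mem x y hx hy hxy h
        rw [hc, mem_singleton] at this
        exact this
      ttb := ttb
      tbb := tbb }
  rcases ttt with h | h | h
  · exact D.false_of_data h
  · exact D.rotate.swap.false_of_data h
  · exact D.rotate.rotate.false_of_data h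

end Main

section Corollaries

variable {R : L → L → Prop} [DecidableRel R] {U : Finset α} {F : Finset (Finset α)}
  {l0 l1 : Finset α → L}

/-- **The relation form holds for three members**, for every symmetric relation with the triple
condition. -/
theorem card_le_omegaCountR_of_card_eq_three (hs : ∀ a b, R a b → R b a) (hR : TripleRel R)
    (hF : ∀ x ∈ F, x ⊆ U) (h3 : F.card = 3) : F.card ≤ omegaCountR R U F l0 l1 := by
  rw [← omegaCountG_slotLabel, h3]
  exact three_le_omegaCountG (fun _ _ h => hs _ _ h) hF h3 (slotTripleRel_of_tripleRel hR l0 l1)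

/-- **(PENT) holds for three members**: every family of exactly three subsets, with any two
labellings into `ZMod 5`, satisfies the pentagon bound (the `|F| = 3` cells of row C-050, for every
ground set). -/
theorem card_le_omegaCountR_pent_of_card_eq_three {l0 l1 : Finset α → ZMod 5}
    (hF : ∀ x ∈ F, x ⊆ U) (h3 : F.card = 3) : F.card ≤ omegaCountR pentR U F l0 l1 :=
  card_le_omegaCountR_of_card_eq_three (fun _ _ h => pentR_symm h) pentR_tripleRel hF h3

end Corollaries

end ThreeMembers

end PercRepro.MSTight
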